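import Summits.BirchSwinnertonDyer.Rank1Residual.Supersingular.JetchevIndexRoute
import Summits.BirchSwinnertonDyer.Rank1Residual.Supersingular.DescentLowerBoundRankOne
import Literature.NumberTheory.EllipticCurves.BSDQuadraticDescentTorsionOddPartProofs
import HarnessLib

/-!
# Good supersingular classes X6 / X7 / X8, analytic rank `≤ 1`, `#Ш_an = 9`: the SQUEEZE from
# Jetchev's Tamagawa-sharpened Heegner-index bound (upper half, `ord_p [E(K):ℤy_K] ≤ ord_p c_q + 1`)
# and the exact `p`-descent count (lower half, `p^{r+1} ∣ #Sel^(p)`) — cell `b2b-bsdres`,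
# supersingular family prover B = unit `b2b-bsdres-additive-p3`, gen 19 (CLASS-CLOSURE class lead N6·O3)

HONEST FRAMING (run/shared/lean/b2b/bsd-rank1-residual/, verbatim in every file): the goal of the
cell is to DELETE the COMBINATION-SHAPED residual classes of the Birch–Swinnerton-Dyer formula for
ALL analytic-rank `≤ 1` elliptic curves over `ℚ` — "full BSD formula for every rank `≤ 1` curve in
class `C`" assembled STRICTLY from published theorems — so that the rank-`≤ 1` remainder becomes
exactly the CONSTRUCTION-SHAPED classes, which are TYPED (missing-input `Prop`s), NOT attempted.
This is not "finishing BSD". Prove what is provable now; shrink each hard class to its core with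
data; no claim beyond stated classes. X6 / X7 / X8 stay CONSTRUCTION-SHAPED; nothing is booked here
(bookings are the referee's, under the lane's two-implementation rule for index and descent
certificates); PER-PAIR certificate consumers only; theorems only (no definition, no named fact).

## Why this file (class-closure O3 / O4 at `p = 3`, rank one, `3 ∣ #Ш_an`)

After referee A's F3BW / F3BW2 bookings (R198.17 / R202.3: exact two-engine `3`-descent on the
`#Ш_an` `3`-UNIT rank-one good-supersingular-at-`3` rows, class-free kernel
`Typed.bsdp_of_card_selmerGroup_eq_pow_analyticRank`) the rank-one residue of X8 (O3) / X7 (O4) at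
`p = 3` that NO per-pair instrument of record reaches is the `3 ∣ #Ш_an` slice: O3 22 cells, O4@3
35 cells (obsanat `pairs.tsv`; all `#Ш_an = 9·u`, all `ρ̄_{E,3}` surjective; rmap-2 g12/g16
countersigns: "the 57 = 35 + 22 pairs with `3 ∣ #Ш_an` are OUTSIDE the unit route"). There
`BSD(E,3) ⟺ #Ш(E)[3^∞] = 9`, and BOTH halves are finite certificates against PUBLISHED theorems:
* LOWER `9 ∣ #Ш(E)`: an exact `3`-descent with `dim_𝔽₃ Sel^(3)(E/ℚ) = 2 = r + 1` (Cremona's generator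
  located in it), read by `missingLowerBoundAt_of_casselsTate_of_pow_succ_dvd_card_selmerGroup`
  (x10b, `DescentLowerBoundRankOne.lean`: Mordell–Weil + Silverman X.4.2 + Cassels–Tate squareness);
* UPPER `ord_3 #Ш(E) ≤ 2`: Jetchev, Compos. Math. 144 (2008) Cor. 1.5 (tree fact
  `Jetchev2008.cor15_padicValNat_card_primaryComponent_sha_le`, A27, PUB: `p ∤ N`, `ρ̄_{E,p}` onto,
  optimal parametrisation, Heegner point `y_K` of infinite order ⇒
  `ord_p #Ш(E/K)[p^∞] + 2·ord_p c_q ≤ 2·ord_p [E(K) : ℤ y_K]` for every `q ∣ N`) with an index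
  certificate `ord_p [E(K) : ℤ y_K] ≤ ord_p c_q(E) + 1` for ONE `q ∣ N` — by Gross–Zagier and the BSD
  shape over `K`, `#Ш_an(E) = 9` forces `3 ∣ [E(K) : ℤ y_K]`, so the index-`≤ c_q` form of
  `JetchevIndexRoute.lean` (x10b) can never fire on these rows; the `+ 1` form is the one that can —,
  transported to `ℚ` by the injectivity of restriction `Ш(E/ℚ)[p^∞] → Ш(E/K)[p^∞]` for `p` odd
  (`shaRestriction_eq_zero_iff_of_coprime`, `[K : ℚ] = 2`).
Instruments (not kernel inputs): the cell's two exact `3`-descent engines (x11b `desc3lib.gp`, x10b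
`desc3full_e2.py`; this unit's kit jobs j132399 / j132400 on the 57 rows) and the Heegner-index
engines of record (o5-r2 / harvest-1, `decide`-checked index records as in `X10bHeegnerIndexRecords`).

## Contents (theorems only; binders `hJ` = A27 Jetchev Cor. 1.5, `hKo` = Kolyvagin finiteness over `K`,
`hCT` = bsd.S18 Cassels–Tate, `hGZK` = bsd.S17, `hmod` = modularity — all PUBLISHED)
* §0 `natCard_primaryComponent_sha_le_baseChange` — `p ∤ [K : ℚ]`, `Ш(E/ℚ)` and `Ш(E/K)` finite ⇒
  `#Ш(E/ℚ)[p^∞] ≤ #Ш(E/K)[p^∞]` (restriction is injective on the `p`-primary part);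
  `padicValNat_shaOrder_le_of_jetchevTamagawaCertificate` — the `+ k` index certificate gives
  `ord_p #Ш(E/ℚ) ≤ 2k`; `missingUpperBoundAt_of_jetchevTamagawaCertificate` (typed currency).
* §1 class-free squeeze `bsdp_of_jetchev_of_casselsTate_of_card_selmerGroup` (analytic rank `≤ 1`,
  `ord_p #Ш_an = 2`, index certificate `+ 1`, descent count `p^{r_an+1} ∣ #Sel^(p)`), and the
  half-closed shape `bsdp_of_missingUpperBoundAt_of_casselsTate_of_card_selmerGroup` (the descent
  certificate in hand, the upper half the ONE remaining named input of the pair).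
* §2 X8 (`p = 3`; `3 ∤ N` derived), X7 (odd `p`, `Surj` binder), X6 (surjectivity automatic) instances
  `X8/X7/X6.bsdp_of_jetchevSucc_of_casselsTate_of_card_selmerGroup`.
NOT here: any evaluation of an index or a Selmer group; any class statement; the Miller–Cha form
(Miller 2011 Thm. 5.4 carries the FLAG `Miller11-Thm54-Cha-case` and is not needed: Jetchev's
Hypothesis (∗) is met on every target row).

References: [Jetchev2008] Hypothesis (∗), Thm. 1.4, Cor. 1.5 (p. 3); [GrossLMS1991] Thm. 1.3;
[KolyvaginEulerSystems1990] Thm. A; [SilvermanAEC2009] X.4.2, X.4.14; [SerreGaloisCohomology1997]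
I.§2.4; [Miller2011LMS] Def. 1.1; [Serre1972] §1.11 Prop. 12, §5.4 Prop. 21. Evidence:
`HOME/class-closure/O3/STATEMENT.md` GEN-19 addendum, `HOME/b2b-bsdres-additive-p3/g19/`.
-/

noncomputable section

open scoped Classical

open WeierstrassCurve Literature.NumberTheory.EllipticCurves
  Literature.NumberTheory.EllipticCurves.ModularForms
  Literature.NumberTheory.EllipticCurves.Rank1Residual
  Literature.NumberTheory.EllipticCurves.Rank1Residual.Typed
  Summit.BirchSwinnertonDyer.BirchSwinnertonDyer.Rank1Residual

namespace Summit.BirchSwinnertonDyer.Rank1Residual.Supersingular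

variable (W : WeierstrassCurve ℚ) [W.IsElliptic] [W.IsGloballyMinimal] (p : ℕ) [hp : Fact p.Prime]

/-! ## §0 The `p`-primary part under base change and the `+ k` index certificate -/

omit [W.IsElliptic] [W.IsGloballyMinimal] hp in
/-- **Restriction is injective on the `p`-primary part when `p ∤ [K : ℚ]`** (`K/ℚ` Galois): for
finite `Ш(E/ℚ)` and `Ш(E/K)`, `#Ш(E/ℚ)[p^∞] ≤ #Ш(E/K)[p^∞]`. The kernel of
`Ш(E/ℚ) → Ш(E/K)` is killed by `[K : ℚ]` (restriction–corestriction), so it meets the `p`-primary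
part trivially (`shaRestriction_eq_zero_iff_of_coprime` at `n = p^e`).
[cite: SerreGaloisCohomology1997, I.§2.4 Cor. to Prop. 9] -/
theorem natCard_primaryComponent_sha_le_baseChange (K : Type) [Field K] [NumberField K]
    [IsGalois ℚ K] (hcop : p.Coprime (Module.finrank ℚ K)) [Finite W.sha]
    [Finite (W.baseChange K).sha] :
    Nat.card (AddCommGroup.primaryComponent W.sha p) ≤
      Nat.card (AddCommGroup.primaryComponent (W.baseChange K).sha p) := by
  -- the restriction of `shaRestriction` to the `p`-primary parts
  have hmem : ∀ x : AddCommGroup.primaryComponent W.sha p,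
      shaRestriction W K x ∈ AddCommGroup.primaryComponent (W.baseChange K).sha p := by
    intro x
    obtain ⟨e, he⟩ := (AddCommGroup.mem_primaryComponent (p := p)).mp x.2
    exact (AddCommGroup.mem_primaryComponent (p := p)).mpr ⟨e, by rw [← map_nsmul, he, map_zero]⟩
  let g : AddCommGroup.primaryComponent W.sha p →
      AddCommGroup.primaryComponent (W.baseChange K).sha p :=
    fun x ↦ ⟨shaRestriction W K x, hmem x⟩
  have hg : Function.Injective g := by
    intro x y hxy
    have hres : shaRestriction W K (x - y : W.sha) = 0 := by
      have := congrArg Subtype.val hxy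
      simp only [g] at this
      rw [map_sub, this, sub_self]
    have hxy' : ((x - y : AddCommGroup.primaryComponent W.sha p) : W.sha) ∈
        AddCommGroup.primaryComponent W.sha p := (x - y).2
    obtain ⟨e, he⟩ := (AddCommGroup.mem_primaryComponent (p := p)).mp hxy'
    have hcop' : (p ^ e).Coprime (Module.finrank ℚ K) := Nat.Coprime.pow_left e hcop
    have h0 : ((x - y : AddCommGroup.primaryComponent W.sha p) : W.sha) = 0 :=
      (shaRestriction_eq_zero_iff_of_coprime W K hcop' _ he).mp
        (by simpa only [AddSubgroupClass.coe_sub] using hres)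
    exact sub_eq_zero.mp (Subtype.ext h0)
  exact Nat.card_le_card_of_injective g hg

omit [W.IsGloballyMinimal] in
/-- **Jetchev's Tamagawa-sharpened bound with a `+ k` index certificate gives `ord_p #Ш(E/ℚ) ≤ 2k`.**
For `E/ℚ` with `Ш(E/ℚ)` finite, an odd prime `p ∤ N` with `ρ̄_{E,p}` surjective, an imaginary
quadratic `K` (`d_K ≠ −3`) with the Heegner hypothesis for the level `N`, an optimal parametrisation
datum (`hopt`), a Heegner point `P = y_K` of infinite order and ONE prime `q ∣ N` with
`ord_p [E(K) : ℤ P] ≤ ord_p c_q(E) + k`: Jetchev 2008 Cor. 1.5 (`hJ`, tree monotone form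
`ord_p #Ш(E/K)[p^∞] + 2 ord_p c_q ≤ 2 ord_p [E(K) : ℤ P]`) gives `ord_p #Ш(E/K)[p^∞] ≤ 2k`
(`Ш(E/K)` finite by Kolyvagin, `hKo`), and `#Ш(E/ℚ)[p^∞] ≤ #Ш(E/K)[p^∞]`
(`natCard_primaryComponent_sha_le_baseChange`, `p` odd, `[K : ℚ] = 2`). Per curve; nothing booked.
[cite: Jetchev2008, Hypothesis (*), Cor. 1.5 (p. 3)] [cite: GrossLMS1991, §1 Thm. 1.3] -/
theorem padicValNat_shaOrder_le_of_jetchevTamagawaCertificate {N : ℕ} [NeZero N] {K : Type}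
    [Field K] [NumberField K] (hKo : kolyvagin N W K)
    (hJ : Jetchev2008.cor15_padicValNat_card_primaryComponent_sha_le)
    (hK : IsImaginaryQuadratic K) (hD3 : NumberField.discr K ≠ -3)
    (hH : SatisfiesHeegnerHypothesis N K)
    (hopt : ∃ Dt : ModularParametrizationData W N,
      ∀ z ∈ Dt.L.lattice, ∃ w ∈ periodLattice Dt.f, z = (Dt.c : ℂ) * w)
    {P : (W.baseChange K).toAffine.Point} (hP : IsHeegnerPoint N W K P) (hnt : ¬ IsOfFinAddOrder P)
    (hp2 : p ≠ 2) (hpN : ¬ p ∣ N) (hρ : W.HasSurjectiveModNGaloisRep p)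
    (q : ℕ) [Fact q.Prime] (hqN : q ∣ N) [Finite W.sha] {k : ℕ}
    (hI : padicValNat p (AddSubgroup.zmultiples P).index ≤
      padicValNat p ((W.baseChange ℚ_[q]).localTamagawaNumber ℤ_[q]) + k) :
    padicValNat p W.shaOrder ≤ 2 * k := by
  have hpp : p.Prime := hp.out
  obtain ⟨-, hfinK⟩ := hKo hK hH hP hnt
  haveI : Finite (W.baseChange K).sha := hfinK
  have hb := hJ N W K hK hD3 hH hopt hP hnt p hp2 hpN hρ q hqN
  -- `ord_p #Ш(E/K) ≤ 2k`
  have hK2 : padicValNat p (Nat.card (W.baseChange K).sha) ≤ 2 * k := by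
    rw [← padicValNat_card_addPrimaryComponent (A := (W.baseChange K).sha) p]
    omega
  -- `p^{ord_p #Ш(E/ℚ)} = #Ш(E/ℚ)[p^∞] ≤ #Ш(E/K)[p^∞] = p^{ord_p #Ш(E/K)}`
  haveI : IsGalois ℚ K := by
    haveI : Algebra.IsQuadraticExtension ℚ K := ⟨hK.1⟩
    infer_instance
  have hcop : p.Coprime (Module.finrank ℚ K) := by
    rw [hK.1]
    exact (Nat.coprime_primes hpp Nat.prime_two).mpr hp2
  have hle := natCard_primaryComponent_sha_le_baseChange W p K hcop
  rw [natCard_primaryComponent_eq_pow_padicValNat (A := W.sha) p,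
    natCard_primaryComponent_eq_pow_padicValNat (A := (W.baseChange K).sha) p,
    Nat.pow_le_pow_iff_right hpp.one_lt] at hle
  rw [WeierstrassCurve.shaOrder]
  exact hle.trans hK2

omit [W.IsGloballyMinimal] in
/-- **The `+ k` index certificate in the typed currency: `MissingUpperBoundAt W p`** at a pair with
analytic rank `≤ 1` (GZK `hGZK`: `Ш(E/ℚ)` finite) and `#Ш_an = s`, `2k ≤ ord_p s`.
[cite: Jetchev2008, Cor. 1.5 (p. 3)] [cite: Miller2011LMS, Def. 1.1 (arXiv:1010.2431 p. 3)] -/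
theorem missingUpperBoundAt_of_jetchevTamagawaCertificate {N : ℕ} [NeZero N] {K : Type}
    [Field K] [NumberField K] (hKo : kolyvagin N W K)
    (hJ : Jetchev2008.cor15_padicValNat_card_primaryComponent_sha_le)
    (hGZK : rank_eq_analyticRank_of_analyticRank_le_one) (hr : W.analyticRank ≤ 1)
    (hK : IsImaginaryQuadratic K) (hD3 : NumberField.discr K ≠ -3)
    (hH : SatisfiesHeegnerHypothesis N K)
    (hopt : ∃ Dt : ModularParametrizationData W N,
      ∀ z ∈ Dt.L.lattice, ∃ w ∈ periodLattice Dt.f, z = (Dt.c : ℂ) * w)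
    {P : (W.baseChange K).toAffine.Point} (hP : IsHeegnerPoint N W K P) (hnt : ¬ IsOfFinAddOrder P)
    (hp2 : p ≠ 2) (hpN : ¬ p ∣ N) (hρ : W.HasSurjectiveModNGaloisRep p)
    (q : ℕ) [Fact q.Prime] (hqN : q ∣ N) {k : ℕ}
    (hI : padicValNat p (AddSubgroup.zmultiples P).index ≤
      padicValNat p ((W.baseChange ℚ_[q]).localTamagawaNumber ℤ_[q]) + k)
    {s : ℚ} (hs : shaAn W = (s : ℂ)) (hv : (2 * k : ℤ) ≤ padicValRat p s) :
    MissingUpperBoundAt W p := by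
  haveI : Finite W.sha := (hGZK W hr).2
  have h := padicValNat_shaOrder_le_of_jetchevTamagawaCertificate W p hKo hJ hK hD3 hH hopt hP hnt
    hp2 hpN hρ q hqN hI
  refine ⟨s, hs, le_trans ?_ hv⟩
  exact_mod_cast h

/-! ## §1 Class-free squeeze at `ord_p #Ш_an = 2` -/

omit [W.IsGloballyMinimal] in
/-- **Half-closed shape: `BSD(E,p)` from the descent lower half and a NAMED upper half.** Analytic
rank `≤ 1`, `ord_p #Ш_an ≤ 2`, `p ∤ #E(ℚ)_tors`, the exact-descent count `p^{r_an+1} ∣ #Sel^(p)(E/ℚ)`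
(`dim_𝔽_p Sel^(p) ≥ r_an + 1`; LOWER half by `missingLowerBoundAt_of_casselsTate_of_pow_succ_dvd_card_selmerGroup`,
Cassels–Tate `hCT`), and `MissingUpperBoundAt W p` (the ONE remaining named input of the pair — an
index certificate, §0, or any other upper-bound route) ⇒ `BSD(E,p)` (`bsdp_of_missingPPartAt`).
Class-free; per pair. [cite: SilvermanAEC2009, Thm. X.4.14] [cite: Miller2011LMS, §1 and Def. 1.1] -/
theorem bsdp_of_missingUpperBoundAt_of_casselsTate_of_card_selmerGroup
    (hCT : exists_casselsTate_pairing (K := ℚ))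
    (hGZK : rank_eq_analyticRank_of_analyticRank_le_one) (hr : W.analyticRank ≤ 1)
    (htors : ¬ p ∣ W.torsionOrder) {s : ℚ} (hs : shaAn W = (s : ℂ)) (hv : padicValRat p s ≤ 2)
    (hcard : p ^ (W.analyticRank + 1) ∣ Nat.card (W.selmerGroup (p : ℤ)))
    (hup : MissingUpperBoundAt W p) : BSDp W p :=
  bsdp_of_missingPPartAt W p hGZK hr
    (missingPPartAt_of_lower_of_upper W p
      (missingLowerBoundAt_of_casselsTate_of_pow_succ_dvd_card_selmerGroup W p hCT hGZK hr htors hs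
        hv hcard) hup)

omit [W.IsGloballyMinimal] in
/-- **The squeeze, class-free: `BSD(E,p)` at `ord_p #Ш_an = 2` from Jetchev's `+ 1` index certificate
(upper) and the exact-descent count `p^{r_an+1} ∣ #Sel^(p)(E/ℚ)` (lower).** Binders: Jetchev 2008
Cor. 1.5 (`hJ`, A27), Kolyvagin (`hKo`), Cassels–Tate (`hCT`), GZK (`hGZK`) — PUBLISHED; per-pair
data: the Heegner certificate (`K`, `d_K ≠ −3`, Heegner hypothesis, optimal datum, `P = y_K` of
infinite order, `p` odd, `p ∤ N`, `ρ̄_{E,p}` onto, one `q ∣ N` with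
`ord_p [E(K):ℤP] ≤ ord_p c_q + 1`), `p ∤ #E(ℚ)_tors`, `#Ш_an = s` with `ord_p s = 2`, and the descent
count. Per curve; not a class theorem. [cite: Jetchev2008, Cor. 1.5 (p. 3)]
[cite: SilvermanAEC2009, Thm. X.4.2(a) and X.4.14] [cite: Miller2011LMS, §1 and Def. 1.1] -/
theorem bsdp_of_jetchev_of_casselsTate_of_card_selmerGroup {N : ℕ} [NeZero N] {K : Type}
    [Field K] [NumberField K] (hKo : kolyvagin N W K)
    (hJ : Jetchev2008.cor15_padicValNat_card_primaryComponent_sha_le)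
    (hCT : exists_casselsTate_pairing (K := ℚ))
    (hGZK : rank_eq_analyticRank_of_analyticRank_le_one) (hr : W.analyticRank ≤ 1)
    (hK : IsImaginaryQuadratic K) (hD3 : NumberField.discr K ≠ -3)
    (hH : SatisfiesHeegnerHypothesis N K)
    (hopt : ∃ Dt : ModularParametrizationData W N,
      ∀ z ∈ Dt.L.lattice, ∃ w ∈ periodLattice Dt.f, z = (Dt.c : ℂ) * w)
    {P : (W.baseChange K).toAffine.Point} (hP : IsHeegnerPoint N W K P) (hnt : ¬ IsOfFinAddOrder P)
    (hp2 : p ≠ 2) (hpN : ¬ p ∣ N) (hρ : W.HasSurjectiveModNGaloisRep p)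
    (q : ℕ) [Fact q.Prime] (hqN : q ∣ N)
    (hI : padicValNat p (AddSubgroup.zmultiples P).index ≤
      padicValNat p ((W.baseChange ℚ_[q]).localTamagawaNumber ℤ_[q]) + 1)
    (htors : ¬ p ∣ W.torsionOrder) {s : ℚ} (hs : shaAn W = (s : ℂ)) (hv : padicValRat p s = 2)
    (hcard : p ^ (W.analyticRank + 1) ∣ Nat.card (W.selmerGroup (p : ℤ))) : BSDp W p :=
  bsdp_of_missingUpperBoundAt_of_casselsTate_of_card_selmerGroup W p hCT hGZK hr htors hs hv.le hcard
    (missingUpperBoundAt_of_jetchevTamagawaCertificate W p hKo hJ hGZK hr hK hD3 hH hopt hP hnt hp2 hpN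
      hρ q hqN (k := 1) hI hs (by rw [hv]; norm_num))

/-! ## §2 Class instances: X8 (`p = 3`), X7 (odd `p`, `Surj` binder), X6 (surjectivity automatic) -/

/-- **X8 (`p = 3`, good supersingular, `a_3 = ±3`), analytic rank `≤ 1`, `#Ш_an = 9·u`: `BSD(E,3)`
from Jetchev's `+ 1` index certificate and the exact `3`-descent count `3^{r_an+1} ∣ #Sel^(3)(E/ℚ)`.**
`ρ̄_{E,3}` onto is the binder `hsurj` (Cremona `galrep`; automatic for semistable `E`); `3 ∤ N`
DERIVED from good reduction (`not_dvd_level_of_isHeegnerPoint_of_good`); `3 ∤ #E(ℚ)_tors` from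
`ClassX8.irr'`. Census targets: class-closure O3's 22 rank-one cells with `ord_3 #Ш_an = 2`
(and N6's `#Ш_an = 9` rank-zero cells, where Wuthrich's Prop. 21 is the alternative upper half).
Per pair; nothing booked. [cite: Jetchev2008, Cor. 1.5 (p. 3)] [cite: SilvermanAEC2009, Thm. X.4.14]
[cite: Serre1972, §1.11 Prop. 12] [cite: Miller2011LMS, §1 and Def. 1.1] -/
theorem X8.bsdp_of_jetchevSucc_of_casselsTate_of_card_selmerGroup {N : ℕ} [NeZero N] {K : Type}
    [Field K] [NumberField K] (hKo : kolyvagin N W K)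
    (hJ : Jetchev2008.cor15_padicValNat_card_primaryComponent_sha_le)
    (hCT : exists_casselsTate_pairing (K := ℚ))
    (hGZK : rank_eq_analyticRank_of_analyticRank_le_one)
    (hX : ClassX8 W p) (hsurj : Surj W p) (hr : W.analyticRank ≤ 1)
    (hK : IsImaginaryQuadratic K) (hD3 : NumberField.discr K ≠ -3)
    (hH : SatisfiesHeegnerHypothesis N K)
    (hopt : ∃ Dt : ModularParametrizationData W N,
      ∀ z ∈ Dt.L.lattice, ∃ w ∈ periodLattice Dt.f, z = (Dt.c : ℂ) * w)
    {P : (W.baseChange K).toAffine.Point} (hP : IsHeegnerPoint N W K P) (hnt : ¬ IsOfFinAddOrder P)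
    (q : ℕ) [Fact q.Prime] (hqN : q ∣ N)
    (hI : padicValNat p (AddSubgroup.zmultiples P).index ≤
      padicValNat p ((W.baseChange ℚ_[q]).localTamagawaNumber ℤ_[q]) + 1)
    {s : ℚ} (hs : shaAn W = (s : ℂ)) (hv : padicValRat p s = 2)
    (hcard : p ^ (W.analyticRank + 1) ∣ Nat.card (W.selmerGroup (p : ℤ))) : BSDp W p := by
  have htors : ¬ p ∣ W.torsionOrder := not_dvd_torsionOrder_of_irr W p (ClassX8.irr' W p hX)
  obtain ⟨rfl, hss, -⟩ := hX
  exact bsdp_of_jetchev_of_casselsTate_of_card_selmerGroup W 3 hKo hJ hCT hGZK hr hK hD3 hH hopt hP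
    hnt (by decide) (not_dvd_level_of_isHeegnerPoint_of_good W 3 hP hss.1) hsurj q hqN hI htors hs
    hv hcard

/-- **X7 (good supersingular, `E` not semistable), odd `p`, `ρ̄_{E,p}` onto (`hsurj`, NOT automatic),
analytic rank `≤ 1`, `ord_p #Ш_an = 2`: `BSD(E,p)` from Jetchev's `+ 1` index certificate and the
exact `p`-descent count.** `p ∤ N` DERIVED; `p ∤ #E(ℚ)_tors` from `ClassX7.irr`. Census targets:
class-closure O4@3's 35 rank-one cells with `ord_3 #Ш_an = 2`. Per pair; nothing booked.
[cite: Jetchev2008, Cor. 1.5 (p. 3)] [cite: SilvermanAEC2009, Thm. X.4.14] [cite: Serre1972, §1.11 Prop. 12]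
[cite: Miller2011LMS, §1 and Def. 1.1] -/
theorem X7.bsdp_of_jetchevSucc_of_casselsTate_of_card_selmerGroup {N : ℕ} [NeZero N] {K : Type}
    [Field K] [NumberField K] (hKo : kolyvagin N W K)
    (hJ : Jetchev2008.cor15_padicValNat_card_primaryComponent_sha_le)
    (hCT : exists_casselsTate_pairing (K := ℚ))
    (hGZK : rank_eq_analyticRank_of_analyticRank_le_one)
    (hX : ClassX7 W p) (hp2 : p ≠ 2) (hsurj : Surj W p) (hr : W.analyticRank ≤ 1)
    (hK : IsImaginaryQuadratic K) (hD3 : NumberField.discr K ≠ -3)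
    (hH : SatisfiesHeegnerHypothesis N K)
    (hopt : ∃ Dt : ModularParametrizationData W N,
      ∀ z ∈ Dt.L.lattice, ∃ w ∈ periodLattice Dt.f, z = (Dt.c : ℂ) * w)
    {P : (W.baseChange K).toAffine.Point} (hP : IsHeegnerPoint N W K P) (hnt : ¬ IsOfFinAddOrder P)
    (q : ℕ) [Fact q.Prime] (hqN : q ∣ N)
    (hI : padicValNat p (AddSubgroup.zmultiples P).index ≤
      padicValNat p ((W.baseChange ℚ_[q]).localTamagawaNumber ℤ_[q]) + 1)
    {s : ℚ} (hs : shaAn W = (s : ℂ)) (hv : padicValRat p s = 2)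
    (hcard : p ^ (W.analyticRank + 1) ∣ Nat.card (W.selmerGroup (p : ℤ))) : BSDp W p :=
  bsdp_of_jetchev_of_casselsTate_of_card_selmerGroup W p hKo hJ hCT hGZK hr hK hD3 hH hopt hP hnt hp2
    (not_dvd_level_of_isHeegnerPoint_of_good W p hP hX.1.1) hsurj q hqN hI
    (not_dvd_torsionOrder_of_irr W p (ClassX7.irr W p hp2 hX)) hs hv hcard

/-- **X6 (good supersingular, `E` semistable), odd `p`, analytic rank `≤ 1`, `ord_p #Ш_an = 2`:
`BSD(E,p)` from Jetchev's `+ 1` index certificate and the exact `p`-descent count** — surjectivity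
AUTOMATIC (`ClassX6.surj`, Serre §5.4 Prop. 21), `p ∤ N` DERIVED, `p ∤ #E(ℚ)_tors` from `ClassX6.irr`.
A flag-free alternative, on the `#Ш_an = 9` rank-one X6 rows, to the Sprung 2024 Cor. 1.3 (ii) upper
half of `X6.bsdp_of_casselsTate_of_pow_succ_dvd_card_selmerGroup`. Per pair; nothing booked.
[cite: Jetchev2008, Cor. 1.5 (p. 3)] [cite: SilvermanAEC2009, Thm. X.4.14]
[cite: Serre1972, §1.11 Prop. 12 and §5.4 Prop. 21 i)] [cite: Miller2011LMS, §1 and Def. 1.1] -/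
theorem X6.bsdp_of_jetchevSucc_of_casselsTate_of_card_selmerGroup {N : ℕ} [NeZero N] {K : Type}
    [Field K] [NumberField K] (hKo : kolyvagin N W K)
    (hJ : Jetchev2008.cor15_padicValNat_card_primaryComponent_sha_le)
    (hCT : exists_casselsTate_pairing (K := ℚ))
    (hGZK : rank_eq_analyticRank_of_analyticRank_le_one)
    (hX : ClassX6 W p) (hp2 : p ≠ 2) (hr : W.analyticRank ≤ 1)
    (hK : IsImaginaryQuadratic K) (hD3 : NumberField.discr K ≠ -3)
    (hH : SatisfiesHeegnerHypothesis N K)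
    (hopt : ∃ Dt : ModularParametrizationData W N,
      ∀ z ∈ Dt.L.lattice, ∃ w ∈ periodLattice Dt.f, z = (Dt.c : ℂ) * w)
    {P : (W.baseChange K).toAffine.Point} (hP : IsHeegnerPoint N W K P) (hnt : ¬ IsOfFinAddOrder P)
    (q : ℕ) [Fact q.Prime] (hqN : q ∣ N)
    (hI : padicValNat p (AddSubgroup.zmultiples P).index ≤
      padicValNat p ((W.baseChange ℚ_[q]).localTamagawaNumber ℤ_[q]) + 1)
    {s : ℚ} (hs : shaAn W = (s : ℂ)) (hv : padicValRat p s = 2)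
    (hcard : p ^ (W.analyticRank + 1) ∣ Nat.card (W.selmerGroup (p : ℤ))) : BSDp W p :=
  bsdp_of_jetchev_of_casselsTate_of_card_selmerGroup W p hKo hJ hCT hGZK hr hK hD3 hH hopt hP hnt hp2
    (not_dvd_level_of_isHeegnerPoint_of_good W p hP hX.1.1) (ClassX6.surj W p hp2 hX) q hqN hI
    (not_dvd_torsionOrder_of_irr W p (ClassX6.irr W p hp2 hX)) hs hv hcard

end Summit.BirchSwinnertonDyer.Rank1Residual.Supersingular

end
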